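import Mathlib
import Summits.NavierStokesRegularity.FluidComputer.AbcContestIR300

/-!
# CONTEST-I AT `R = 300` AS ONE KERNEL SENTENCE — implementation 2's INERTIA cells (instab3 g9, cell `ns-blowup`, 2026-08-27)

HONEST FRAMING (human rulings D-0035/D-0074): **MODEL linear operator, computer-assisted; not NS.** Nothing
here is a statement about Navier–Stokes regularity or blow-up. This is the sibling of
`AbcContestIR300.contestI_R300_i3` with the INERTIA-3L cells of IMPLEMENTATION 2 (instab4 g8, kit j269943:
class II `(r_L, r_H) = (28, 29)`, class I `(28, 29)`) in place of implementation 1's — the two-engine rule at the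
level of kernel implications. Rows, conclusion, framing and the NOT-kernel list are identical to that file's.
bears_on LADDER-NS N1* T6 (contest-I at R 300) / profile W3. WHAT THIS IS NOT: not NS; no certificate re-run;
no number or census word moves.

Mathlib + `AbcContestIR300`; no new definitions; std axioms. [folklore]
-/

noncomputable section

open scoped BigOperators ComplexConjugate InnerProductSpace Matrix
open Finset Matrix MeasureTheory UnitAddTorus

namespace Summit.NavierStokesRegularity.FluidComputer.AbcContestI

open Literature.Analysis.FunctionSpaces Literature.Analysis.FunctionSpaces.Torus
open Literature.Analysis.FunctionSpaces.EuclideanSpace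
open Literature.Analysis.FluidPDE Literature.Analysis.FluidPDE.SteadyLattice
open Summit.NavierStokesRegularity.FluidComputer.AbcClassII
open Summit.NavierStokesRegularity.FluidComputer.AbcClassI (IsClassI)
open Summit.NavierStokesRegularity.FluidComputer.CertificateAbcSpectrum

section Rows

variable (wf : Idx → Fam)
variable (hws : ∀ i : Idx, ∀ k ∉ i.1.1, wf i k = 0)
variable (hwt : ∀ (i : Idx) (k : Fin 3 → ℤ), ∑ j : Fin 3, ((k j : ℤ) : ℂ) * wf i k j = 0)
variable (hwII : ∀ i : Idx, IsClassII (wf i))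
variable (hwon : ∀ (O : Orbit) (a b : Fin (odim O)),
  ∑ k ∈ O.1, (inner ℂ (wf ⟨O, a⟩ k) (wf ⟨O, b⟩ k) : ℂ) = if a = b then 1 else 0)
variable (amc : Idx → Idx → ℂ)
variable (hamc : ∀ i j : Idx, amc i j =
  ∑ k ∈ i.1.1, (inner ℂ (wf i k) (Torus.lerayCoeff k (crossForm 1 1 1 (wf j) k)) : ℂ))
variable (e : ∀ O : Orbit, OrthonormalBasis (Fin (odim O)) ℝ (realSpace O.1))
variable (bf : Idx → Fam)
variable (hbf : ∀ i : Idx, bf i = extend i.1.1 ((e i.1 i.2 : realSpace i.1.1) : EuclideanSpace ℂ (↥i.1.1 × Fin 3)))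
variable (am : Idx → Idx → ℝ)
variable (ham : ∀ i j : Idx, am i j =
  (∑ k ∈ i.1.1, (inner ℂ (bf i k) (Torus.lerayCoeff k (crossForm 1 1 1 (bf j) k)) : ℂ)).re)
variable (wfI : AbcClassI.Idx → Fam)
variable (hwsI : ∀ i : AbcClassI.Idx, ∀ k ∉ i.1.1, wfI i k = 0)
variable (hwtI : ∀ (i : AbcClassI.Idx) (k : Fin 3 → ℤ), ∑ j : Fin 3, ((k j : ℤ) : ℂ) * wfI i k j = 0)
variable (hwI : ∀ i : AbcClassI.Idx, IsClassI (wfI i))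
variable (hwonI : ∀ (O : Orbit) (a b : Fin (AbcClassI.odim O)),
  ∑ k ∈ O.1, (inner ℂ (wfI ⟨O, a⟩ k) (wfI ⟨O, b⟩ k) : ℂ) = if a = b then 1 else 0)
variable (amcI : AbcClassI.Idx → AbcClassI.Idx → ℂ)
variable (hamcI : ∀ i j : AbcClassI.Idx, amcI i j =
  ∑ k ∈ i.1.1, (inner ℂ (wfI i k) (Torus.lerayCoeff k (crossForm 1 1 1 (wfI j) k)) : ℂ))

include hws hwt hwII hwon hamc hbf ham hwsI hwtI hwI hwonI hamcI in
/-- **CONTEST-I AT R = 300 AS ONE KERNEL SENTENCE — IMPLEMENTATION 2's INERTIA cells (class II (28, 29), class I (28, 29), j269943).** HYPOTHESES (four script-certified finite-matrix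
fact families, each VERBATIM as in the file that consumes it): the T1 row `Row3002C` (class II, implementation C,
complex orbit bases `wf`: `AbcClassIIEigenpairRow3002CClassical`); the INERTIA-3L class-II cell `(300, II, 1/5, 1;
28, 29)` in the real orthonormal orbit bases `e` (`AbcInertiaExactlyOneTight.R300II_exactly_one_tight_i4`); the
T2 row `Row3001C` (class I, implementation C, complex orbit bases `wfI`: `AbcClassIEigenpairRow3001CClassical`); the
INERTIA-3L class-I cell `(300, I, 43/200, 2; 28, 29)` on `AbcClassI.amat` (`AbcInertiaCIExactlyPair.R300I_exactly_pair_i4`).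
CONCLUSION: the class-II leader `λ_II` (real, `|λ_II − 0.2617112…| ≤ 5.1·10⁻¹²`, a classical class-II eigenfunction,
ALL of `σ_p(L|II) ∩ {Re ≥ 1/5}`), the class-I Hopf pair `λ_I, conj λ_I` (`|λ_I − (0.2641917… + 0.6430289… i)| ≤
7.5·10⁻¹²`, `Im λ_I > 0`, classical class-I eigenfunctions, ALL of `σ_p(L|I) ∩ {Re ≥ 43/200}`), `λ_II < Re λ_I`, and
**every classical class-II eigenpair `(z, u)` has `Re z < Re λ_I`** — the class-I Hopf pair LEADS the whole class-II
point spectrum (contest-I, T6). MODEL; conditional on the four certifier audits and AUDIT-BASIS; classes III–V untreated. -/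
theorem contestI_R300_i4
    (vt : Idx → ℂ) (hvt0 : ∀ i, i ∉ cubeIdx 96 → vt i = 0)
    (hres : ∑ i ∈ cubeIdx 96 ∪ (cubeIdx 96).biUnion nbrIdx,
      ‖(if i ∈ cubeIdx 96 then ((((Row3002C.lamRe : ℚ) : ℝ) : ℂ) - ((-(onormSq i.1 / 300) : ℝ) : ℂ)) * vt i
          else 0) - ∑ j ∈ cubeIdx 96, amc i j * vt j‖ ^ 2 ≤ ((Row3002C.rnorm : ℚ) : ℝ) ^ 2)
    (hntb : ∑ i ∈ cubeIdx 96 \ cubeIdx 22, ‖vt i‖ ^ 2 ≤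
      (((5848008621608657 : ℚ) / 576460752303423488 : ℚ) : ℝ) ^ 2)
    (Binv : ((↥(cubeIdx 22) → ℂ) × ℂ) →ₗ[ℂ] ((↥(cubeIdx 22) → ℂ) × ℂ))
    (hBinv : ∀ (c : ↥(cubeIdx 22) → ℂ) (m : ℂ),
      Binv (fun i : ↥(cubeIdx 22) =>
          ((((Row3002C.lamRe : ℚ) : ℝ) : ℂ) - ((-(onormSq i.1.1 / 300) : ℝ) : ℂ)) * c i -
          ∑ j : ↥(cubeIdx 22), amc i j * c j + m * vt i,
        ∑ i : ↥(cubeIdx 22), conj (vt i) * c i) = (c, m))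
    (hαM : ∀ (c : ↥(cubeIdx 22) → ℂ) (g : ℂ),
      ∑ j : ↥(cubeIdx 22), ‖(Binv (c, g)).1 j‖ ^ 2 + ‖(Binv (c, g)).2‖ ^ 2 ≤
        ((Row3002C.alpha0 : ℚ) : ℝ) ^ 2 * (∑ i : ↥(cubeIdx 22), ‖c i‖ ^ 2 + ‖g‖ ^ 2))
    (hβBM : ∀ w : Idx → ℂ,
      ∑ j : ↥(cubeIdx 22), ‖(Binv (fun i : ↥(cubeIdx 22) => -∑ j ∈ nbrIdx i \ cubeIdx 22,
          amc i j * w j, 0)).1 j‖ ^ 2 +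
        ‖(Binv (fun i : ↥(cubeIdx 22) => -∑ j ∈ nbrIdx i \ cubeIdx 22,
          amc i j * w j, 0)).2‖ ^ 2 ≤
        ((Row3002C.betaB : ℚ) : ℝ) ^ 2 * ∑ j ∈ (cubeIdx 22).biUnion nbrIdx \ cubeIdx 22, ‖w j‖ ^ 2)
    (hβCM : ∀ (c : ↥(cubeIdx 22) → ℂ) (g : ℂ),
      ∑ i ∈ ((cubeIdx 22).biUnion nbrIdx ∪ cubeIdx 96) \ cubeIdx 22,
        ‖-∑ j : ↥(cubeIdx 22), amc i j * (Binv (c, g)).1 j +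
          (Binv (c, g)).2 * vt i‖ ^ 2 ≤
        ((Row3002C.betaC : ℚ) : ℝ) ^ 2 * (∑ i : ↥(cubeIdx 22), ‖c i‖ ^ 2 + ‖g‖ ^ 2))
    (hgBM : ∀ w : Idx → ℂ,
      ‖(Binv (fun i : ↥(cubeIdx 22) => ∑ j ∈ nbrIdx i \ cubeIdx 22,
          amc i j * w j, 0)).2‖ ^ 2 ≤
        (((959475027496217 : ℚ) / 281474976710656 : ℚ) : ℝ) ^ 2 *
          ∑ j ∈ (cubeIdx 22).biUnion nbrIdx \ cubeIdx 22, ‖w j‖ ^ 2)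
    (hshellM : ∀ w : Idx → ℂ, (∀ i ∈ cubeIdx 22, w i = 0) →
      (((5501868957119981 : ℚ) / 9007199254740992 : ℚ) : ℝ) * ∑ i ∈ cubeIdx (22 + 1) \ cubeIdx 22, ‖w i‖ ^ 2 ≤
        ∑ i ∈ cubeIdx (22 + 1) \ cubeIdx 22,
          ((((Row3002C.lamRe : ℚ) : ℝ) : ℂ).re - (-(onormSq i.1 / 300)) - Real.sqrt 2) * ‖w i‖ ^ 2 -
        RCLike.re (∑ i ∈ (cubeIdx 22).biUnion nbrIdx \ cubeIdx 22,
          conj (∑ j : ↥(cubeIdx 22), amc i j *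
            (Binv (fun i : ↥(cubeIdx 22) => ∑ j ∈ nbrIdx i \ cubeIdx 22,
              amc i j * w j, 0)).1 j) * w i))
    {HL HH HB : Finset Idx}
    (hHL : ∀ i : Idx, i ∈ HL ↔ onormSq i.1 ≤ (28 : ℝ) ^ 2)
    (hHH : ∀ i : Idx, i ∈ HH ↔ onormSq i.1 ≤ (29 : ℝ) ^ 2)
    (hHB : ∀ i : Idx, i ∈ HB ↔ (29 : ℝ) ^ 2 < onormSq i.1 ∧ onormSq i.1 ≤ ((29 : ℝ) + 1) ^ 2)
    (GH' Ah' : Matrix ↥HH ↥HH ℝ) (AHB' : Matrix ↥HH ↥HB ℝ) (ABH' : Matrix ↥HB ↥HH ℝ) (E : ↥HB → ℝ)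
    (V' : Matrix ↥HH (Fin 1) ℝ) (hGH' : GH'ᵀ = GH')
    (hAh' : Ah' = Matrix.of fun i j : ↥HH =>
      (if i = j then -(onormSq i.1.1 / (300 : ℝ)) - (1 / 5 : ℝ) else 0) + am i.1 j.1)
    (hAHB' : AHB' = Matrix.of fun (i : ↥HH) (l : ↥HB) => am i.1 l.1)
    (hABH' : ABH' = Matrix.of fun (l : ↥HB) (i : ↥HH) => am l.1 i.1)
    (hE : E = fun l : ↥HB => onormSq l.1.1 / (300 : ℝ) + (1 / 5 : ℝ) - Real.sqrt 2)
    (hR1' : ∀ x : ↥HH → ℝ, x ≠ 0 →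
      x ⬝ᵥ ((GH' * Ah' + Ah'ᵀ * GH' + (1 / 2 : ℝ) • ((GH' * AHB' + ABH'ᵀ) * Matrix.diagonal (fun l => (E l)⁻¹) *
        (GH' * AHB' + ABH'ᵀ)ᵀ)) *ᵥ x) < 0)
    (hR2' : ∀ x : ↥HH → ℝ, 0 ≤ x ⬝ᵥ ((GH' + V' * V'ᵀ) *ᵥ x))
    (vtI : AbcClassI.Idx → ℂ) (hvt0I : ∀ i, i ∉ AbcClassI.cubeIdx 96 → vtI i = 0)
    (hresI : ∑ i ∈ AbcClassI.cubeIdx 96 ∪ (AbcClassI.cubeIdx 96).biUnion AbcClassI.nbrIdx,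
      ‖(if i ∈ AbcClassI.cubeIdx 96 then (((((Row3001C.lamRe : ℚ) : ℝ) : ℂ) + (((Row3001C.lamIm : ℚ) : ℝ) : ℂ) * Complex.I) - ((-(onormSq i.1 / 300) : ℝ) : ℂ)) * vtI i
          else 0) - ∑ j ∈ AbcClassI.cubeIdx 96, amcI i j * vtI j‖ ^ 2 ≤ ((Row3001C.rnorm : ℚ) : ℝ) ^ 2)
    (hntbI : ∑ i ∈ AbcClassI.cubeIdx 96 \ AbcClassI.cubeIdx 22, ‖vtI i‖ ^ 2 ≤
      (((2315674124931519 : ℚ) / 288230376151711744 : ℚ) : ℝ) ^ 2)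
    (BinvI : ((↥(AbcClassI.cubeIdx 22) → ℂ) × ℂ) →ₗ[ℂ] ((↥(AbcClassI.cubeIdx 22) → ℂ) × ℂ))
    (hBinvI : ∀ (c : ↥(AbcClassI.cubeIdx 22) → ℂ) (m : ℂ),
      BinvI (fun i : ↥(AbcClassI.cubeIdx 22) =>
          (((((Row3001C.lamRe : ℚ) : ℝ) : ℂ) + (((Row3001C.lamIm : ℚ) : ℝ) : ℂ) * Complex.I) - ((-(onormSq i.1.1 / 300) : ℝ) : ℂ)) * c i -
          ∑ j : ↥(AbcClassI.cubeIdx 22), amcI i j * c j + m * vtI i,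
        ∑ i : ↥(AbcClassI.cubeIdx 22), conj (vtI i) * c i) = (c, m))
    (hαMI : ∀ (c : ↥(AbcClassI.cubeIdx 22) → ℂ) (g : ℂ),
      ∑ j : ↥(AbcClassI.cubeIdx 22), ‖(BinvI (c, g)).1 j‖ ^ 2 + ‖(BinvI (c, g)).2‖ ^ 2 ≤
        ((Row3001C.alpha0 : ℚ) : ℝ) ^ 2 * (∑ i : ↥(AbcClassI.cubeIdx 22), ‖c i‖ ^ 2 + ‖g‖ ^ 2))
    (hβBMI : ∀ w : AbcClassI.Idx → ℂ,
      ∑ j : ↥(AbcClassI.cubeIdx 22), ‖(BinvI (fun i : ↥(AbcClassI.cubeIdx 22) => -∑ j ∈ AbcClassI.nbrIdx i \ AbcClassI.cubeIdx 22,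
          amcI i j * w j, 0)).1 j‖ ^ 2 +
        ‖(BinvI (fun i : ↥(AbcClassI.cubeIdx 22) => -∑ j ∈ AbcClassI.nbrIdx i \ AbcClassI.cubeIdx 22,
          amcI i j * w j, 0)).2‖ ^ 2 ≤
        ((Row3001C.betaB : ℚ) : ℝ) ^ 2 * ∑ j ∈ (AbcClassI.cubeIdx 22).biUnion AbcClassI.nbrIdx \ AbcClassI.cubeIdx 22, ‖w j‖ ^ 2)
    (hβCMI : ∀ (c : ↥(AbcClassI.cubeIdx 22) → ℂ) (g : ℂ),
      ∑ i ∈ ((AbcClassI.cubeIdx 22).biUnion AbcClassI.nbrIdx ∪ AbcClassI.cubeIdx 96) \ AbcClassI.cubeIdx 22,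
        ‖-∑ j : ↥(AbcClassI.cubeIdx 22), amcI i j * (BinvI (c, g)).1 j +
          (BinvI (c, g)).2 * vtI i‖ ^ 2 ≤
        ((Row3001C.betaC : ℚ) : ℝ) ^ 2 * (∑ i : ↥(AbcClassI.cubeIdx 22), ‖c i‖ ^ 2 + ‖g‖ ^ 2))
    (hgBMI : ∀ w : AbcClassI.Idx → ℂ,
      ‖(BinvI (fun i : ↥(AbcClassI.cubeIdx 22) => ∑ j ∈ AbcClassI.nbrIdx i \ AbcClassI.cubeIdx 22,
          amcI i j * w j, 0)).2‖ ^ 2 ≤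
        (((2617195581838679 : ℚ) / 2251799813685248 : ℚ) : ℝ) ^ 2 *
          ∑ j ∈ (AbcClassI.cubeIdx 22).biUnion AbcClassI.nbrIdx \ AbcClassI.cubeIdx 22, ‖w j‖ ^ 2)
    (hshellMI : ∀ w : AbcClassI.Idx → ℂ, (∀ i ∈ AbcClassI.cubeIdx 22, w i = 0) →
      (((5524214073445137 : ℚ) / 9007199254740992 : ℚ) : ℝ) * ∑ i ∈ AbcClassI.cubeIdx (22 + 1) \ AbcClassI.cubeIdx 22, ‖w i‖ ^ 2 ≤
        ∑ i ∈ AbcClassI.cubeIdx (22 + 1) \ AbcClassI.cubeIdx 22,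
          (((((Row3001C.lamRe : ℚ) : ℝ) : ℂ) + (((Row3001C.lamIm : ℚ) : ℝ) : ℂ) * Complex.I).re - (-(onormSq i.1 / 300)) - Real.sqrt 2) * ‖w i‖ ^ 2 -
        RCLike.re (∑ i ∈ (AbcClassI.cubeIdx 22).biUnion AbcClassI.nbrIdx \ AbcClassI.cubeIdx 22,
          conj (∑ j : ↥(AbcClassI.cubeIdx 22), amcI i j *
            (BinvI (fun i : ↥(AbcClassI.cubeIdx 22) => ∑ j ∈ AbcClassI.nbrIdx i \ AbcClassI.cubeIdx 22,
              amcI i j * w j, 0)).1 j) * w i))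
    {HLI HHI HBI : Finset AbcClassI.Idx}
    (hHLI : ∀ i : AbcClassI.Idx, i ∈ HLI ↔ onormSq i.1 ≤ (28 : ℝ) ^ 2)
    (hHHI : ∀ i : AbcClassI.Idx, i ∈ HHI ↔ onormSq i.1 ≤ (29 : ℝ) ^ 2)
    (hHBI : ∀ i : AbcClassI.Idx, i ∈ HBI ↔ (29 : ℝ) ^ 2 < onormSq i.1 ∧ onormSq i.1 ≤ ((29 : ℝ) + 1) ^ 2)
    (GHI AhI : Matrix ↥HHI ↥HHI ℝ) (AHBI : Matrix ↥HHI ↥HBI ℝ) (ABHI : Matrix ↥HBI ↥HHI ℝ) (EI : ↥HBI → ℝ)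
    (VI : Matrix ↥HHI (Fin 2) ℝ) (hGHI : GHIᵀ = GHI)
    (hAhI : AhI = Matrix.of fun i j : ↥HHI =>
      (if i = j then -(onormSq i.1.1 / (300 : ℝ)) - (43 / 200 : ℝ) else 0) + AbcClassI.amat i.1 j.1)
    (hAHBI : AHBI = Matrix.of fun (i : ↥HHI) (l : ↥HBI) => AbcClassI.amat i.1 l.1)
    (hABHI : ABHI = Matrix.of fun (l : ↥HBI) (i : ↥HHI) => AbcClassI.amat l.1 i.1)
    (hEI : EI = fun l : ↥HBI => onormSq l.1.1 / (300 : ℝ) + (43 / 200 : ℝ) - Real.sqrt 2)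
    (hR1I : ∀ x : ↥HHI → ℝ, x ≠ 0 →
      x ⬝ᵥ ((GHI * AhI + AhIᵀ * GHI + (1 / 2 : ℝ) • ((GHI * AHBI + ABHIᵀ) * Matrix.diagonal (fun l => (EI l)⁻¹) *
        (GHI * AHBI + ABHIᵀ)ᵀ)) *ᵥ x) < 0)
    (hR2I : ∀ x : ↥HHI → ℝ, 0 ≤ x ⬝ᵥ ((GHI + VI * VIᵀ) *ᵥ x)) :
    ∃ lamII lamI : ℂ,
      ‖lamII - (((Row3002C.lamRe : ℚ) : ℝ) : ℂ)‖ ≤ ((Row3002C.rho : ℚ) : ℝ) ∧ lamII.im = 0 ∧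
      ‖lamI - ((((Row3001C.lamRe : ℚ) : ℝ) : ℂ) + (((Row3001C.lamIm : ℚ) : ℝ) : ℂ) * Complex.I)‖ ≤
        ((Row3001C.rho : ℚ) : ℝ) ∧ 0 < lamI.im ∧ lamII.re < lamI.re ∧
      (∃ u : UnitAddTorus (Fin 3) → EuclideanSpace ℂ (Fin 3),
        Torus.LinNSResolventRel (1 / (2 * Real.pi * 300)) (Torus.abcFlow 1 1 1) (2 * Real.pi * lamII) u 0 ∧
          u ≠ 0 ∧ IsClassII (mFourierCoeff u)) ∧
      (∃ u : UnitAddTorus (Fin 3) → EuclideanSpace ℂ (Fin 3),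
        Torus.LinNSResolventRel (1 / (2 * Real.pi * 300)) (Torus.abcFlow 1 1 1) (2 * Real.pi * lamI) u 0 ∧
          u ≠ 0 ∧ IsClassI (mFourierCoeff u)) ∧
      (∃ u : UnitAddTorus (Fin 3) → EuclideanSpace ℂ (Fin 3),
        Torus.LinNSResolventRel (1 / (2 * Real.pi * 300)) (Torus.abcFlow 1 1 1) (2 * Real.pi * conj lamI) u 0 ∧
          u ≠ 0 ∧ IsClassI (mFourierCoeff u)) ∧
      (∀ (z : ℂ) (u : UnitAddTorus (Fin 3) → EuclideanSpace ℂ (Fin 3)),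
        Torus.LinNSResolventRel (1 / (2 * Real.pi * 300)) (Torus.abcFlow 1 1 1) (2 * Real.pi * z) u 0 → u ≠ 0 →
          IsClassII (mFourierCoeff u) → (1 / 5 : ℝ) ≤ z.re → z = lamII) ∧
      (∀ (z : ℂ) (u : UnitAddTorus (Fin 3) → EuclideanSpace ℂ (Fin 3)),
        Torus.LinNSResolventRel (1 / (2 * Real.pi * 300)) (Torus.abcFlow 1 1 1) (2 * Real.pi * z) u 0 → u ≠ 0 →
          IsClassI (mFourierCoeff u) → (43 / 200 : ℝ) ≤ z.re → z = lamI ∨ z = conj lamI) ∧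
      ∀ (z : ℂ) (u : UnitAddTorus (Fin 3) → EuclideanSpace ℂ (Fin 3)),
        Torus.LinNSResolventRel (1 / (2 * Real.pi * 300)) (Torus.abcFlow 1 1 1) (2 * Real.pi * z) u 0 → u ≠ 0 →
          IsClassII (mFourierCoeff u) → z.re < lamI.re := by
  obtain ⟨lamII, hcloseII, himII, hreloII, honeII, huniqII⟩ :=
    AbcInertia.R300II_exactly_one_tight_i4 wf hws hwt hwII hwon amc hamc e bf hbf am ham vt hvt0 hres hntb Binv hBinv
      hαM hβBM hβCM hgBM hshellM hHL hHH hHB GH' Ah' AHB' ABH' E V' hGH' hAh' hAHB' hABH' hE hR1' hR2'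
  obtain ⟨lamI, hcloseI, hreloI, himI, hpairI, hpaircI, huniqI⟩ :=
    AbcInertiaCI.R300I_exactly_pair_i4 wfI hwsI hwtI hwI hwonI amcI hamcI vtI hvt0I hresI hntbI BinvI hBinvI
      hαMI hβBMI hβCMI hgBMI hshellMI hHLI hHHI hHBI GHI AhI AHBI ABHI EI VI hGHI hAhI hAHBI hABHI hEI hR1I hR2I
  have hcon := contest_of_exactly_one_of_pair (ν := 1 / (2 * Real.pi * 300)) row3002C_add_rho_lt_row3001C_sub_rho
    AbcInertia.a_le_row3002C lamII hcloseII huniqII lamI hreloI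
  obtain ⟨uII, huII, huII0, huIIcl⟩ := honeII
  exact ⟨lamII, lamI, hcloseII, himII, hcloseI, himI, hcon lamII uII huII huII0 huIIcl, ⟨uII, huII, huII0, huIIcl⟩,
    hpairI, hpaircI, huniqII, huniqI, hcon⟩

end Rows

end Summit.NavierStokesRegularity.FluidComputer.AbcContestI

end
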